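import Literature.MathematicalPhysics.QuantumFieldTheory.Balaban1983to89.B8Eq184Proof
import Literature.MathematicalPhysics.QuantumFieldTheory.Balaban1983to89.B8Eq119TwistedAxial

/-!
# `Balaban1983to89.B8Eq138LandauZd` — T. Bałaban, *Spaces of regular gauge field configurations on a lattice and gauge
# fixing conditions*, Commun. Math. Phys. **99** (1985) 75–102 [Balaban1985RegularSpaces] ("B8"): the Landau gauge
# condition relative to a background, (1.38)/(1.42) «R(U₀)D^{η*}_{U₀}A = 0» and its source form (1.146)
# «R(U₀)D^{η*}_{U₀}A = f», TYPED ON THE `ℤᵈ × 𝔸` CARRIERS OF THE B8 LINEAGE in Lagrange-multiplier form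
# «Δ^η_{U₀}↾Ω₀ (D^{η*}_{U₀}A) = Q′(U₀)ᵀ μ on Ω₀ for some multiplier μ on 𝔅_m» — no scalar product needed

statement-level skeleton of published theorems with citation tags; proofs where landed; nothing here is a claim about the
Yang–Mills mass gap

PDF held: `paper:balaban1985-cmp99-regular-spaces-gauge-fixing` (journal page = PDF page + 74): p. 76 (1.1), p. 80 (1.27), p. 81
(1.29), p. 82 (1.38), pp. 91–93 (1.90)–(1.100), p. 101 (1.146), read on the text layer by this seat (2026-08-26); [4] = T. Bałaban,
*Propagators for lattice gauge theories in a background field*, CMP **99** (1985) 389–434 [Balaban1985BackgroundPropagators] pp.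
393–394 (3.19)–(3.25), through the tree modules `B9Eq325Proj`, `B8Eq127LandauGauge`, `B7Eq78Linearization`.

WHAT IS PRINTED.  p. 80: *"We consider the subspace N(Q′(U₀)) = {λ : Q′(U₀)λ = 0} of the space L²(Ω₀, 𝔤) of functions on Ω₀
with values in the Lie algebra 𝔤. … An operator R(U₀) is defined as an orthogonal projection in this real Hilbert space, onto
the subspace Δ^η_{U₀}N(Q′(U₀)). The Landau gauge condition … R(U₀)D^{η*}_{U₀}(1/i) log U′ = 0. (1.27)"*; p. 82 (1.38)
*"R(U₀)D^{η*}_{U₀}A = 0"* for `U₁ = U′^{u⁻¹} = e^{iηA}` ((1.36)); p. 101 (1.146) *"R(U₀)D^{η*}_{U₀}A = f, where f is a function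
from the space R(U₀), i.e. a Lie algebra valued function defined on Ω₀ and satisfying R(U₀)f = f"*.  [4] p. 394: *"Using the
Lagrange multipliers method … we obtain the formula Rf = (I − G′Q′\*(Q′G′²Q′\*)^{−1}Q′G′)f, (3.25)"*, Δ′_a =
(Δ^η_U + Q′\*aQ′)↾_{Ω₀} ((3.24)), Δ^η_U = D^{η\*}_U D^η_U ((3.23)), Q′_j(U) = Q′(Ūʲ⁻¹)⋯Q′(U) ((3.19)); [B8] (1.1) p. 76:
(D^η_{U,μ}F)(x) = η⁻¹(R(U(x, x + ηe_μ))F(x + ηe_μ) − F(x)), (D^{η*}_{U,ν}F)(x) = η⁻¹(R(U(x, x − ηe_ν))F(x − ηe_ν) − F(x)).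

WHY THIS FILE / THE ONE IDEA (cell `pub-ymgap`, seat `pub-ymgap-dag-n05-a` g4 = the KNIT seat of DAG node N05 = [B8]; it answers
for these carriers the interface I-B8-1 «second half» of `lit-balaban` r05's INTERFACES-B8, recorded in r05's `B8Eq127LandauGauge`
HONEST SCOPE (iv): «once B8's ℤᵈ/𝔸 carriers (`B8Ineq132.covDeriv`) are given a real pairing»).  The Theorem-4 knit on the concrete
carriers (`B8Thm4InductionLocal.thm4_exists_all_levels`, `B8Thm4UniqueLocal.thm4_unique_of_agree`, and `pub-ymgap-dag-n04-b`'s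
`B8Prop3GaugeFixedKLevel.thm4_exists_all_levels_of_b9`) reads (1.38) as an ARBITRARY level-indexed predicate `Lan m W`, because
print's R(U₀) needs the real scalar product of L²(Ω₀, 𝔤), which a general C⋆-algebra fibre `𝔸` does not carry.  The sibling
`B8Eq138Multiplier` proves that NO pairing is needed to STATE the condition: for R of (3.25), built from any two-sided inverse G′ of
Δ′_a and any left inverse of Q′G′²Q′\*, «R f = 0 ⟺ ∃ μ, Δ f = Q′\* μ» (`proj325_apply_eq_zero_iff_exists`, four lines of algebra
over an arbitrary ring), and on [4]'s own lattice carriers (1.38)/(1.146) ARE these multiplier conditions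
(`landau138L_iff_exists`, `landau146L_iff_exists`).  This file therefore DEFINES (1.38)/(1.146) on the `ℤᵈ × 𝔸` carriers in
multiplier form, from three finite stencils that already have a meaning there: the covariant divergence D^{η*}_{U₀} of a bond
field ((1.1)₂ summed over directions: `covDivB`, from `B8Ineq132.covDeriv`), the covariant Laplacian Δ^η_{U₀} = D^{η*}D^η
((3.23): `covLap`, from `B8Ineq132.covDerivFwd`) read with Dirichlet conditions on Ω₀ ((3.24) «↾Ω₀»: zero extension by
`Set.indicator Ω₀`), and the TRANSPOSE STENCIL Q′(U₀)ᵀ of the iterated linearised averaging `B7Eq78Linearization.QprimeIter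
(zdBlocking d L) (bgT L U₀)` of (3.19)/(1.29) (`qprimeT1`: one step, `x ↦ L⁻ᵈ·R(T_j(y, x))⁻¹ν(y)`, `y` the `j`-block of `x`;
`QprimeT`: the steps composed in reverse order; `QT`: summed over the levels `j ≤ m` against the constraint sets `Λ_j`).  The
multiplier `μ : ℕ → Site d → 𝔸` absorbs every positive weight print attaches to the pairing of L²(𝔅) ((3.24): `a_j(Lʲη)^{d−2}`)
and to L²(Ω₀, 𝔤) (`η^d`), so none of them is typed.  For unitary transporters the transpose stencil is the adjoint of Q′ for
ANY Ad-invariant real scalar product on the fibre (`⟨ν, uλu⁻¹⟩ = ⟨u⁻¹νu, λ⟩`); that identification, and the one with print's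
projection form, are NOT made here — by `B8Eq138Multiplier` they consume exactly the existence of the (3.25)-inverses, i.e. [4]
Theorem 3.11 (the in-edge b9 of the node), at whatever pairing the family of record carries.

WHAT THIS FILE DECLARES (definitions + small API; kernel, 0 sorry).
* defs: `covDivB`, `covLap`, `qprimeT1`, `QprimeT`, `QT`, `logCfg` (A = (iη)⁻¹ log W bondwise, the reading of (1.36)/(1.69)
  used by `B8Thm4TruncationLocal.base_datum`), `InR138` («f from the space R(U₀)» = f ∈ Δ^η_{U₀}↾Ω₀ N(Q′(U₀)), as ∃λ),
  **`IsLandau138`** ((1.38)/(1.42) for a bond field A), **`IsLandau146`** ((1.146)), **`IsLandau138W`** ((1.38) for the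
  configuration `W = e^{iηA}`, the instance `Lan m W` of the Theorem-4 knit), `IsLandau146W`.
* certificates: **`sum_pairing_Qprime_eq`** — `qprimeT1` IS the transpose of the averaging step of (3.19)/(1.29) relative to
  EVERY `Ad`-invariant real-bilinear pairing of the fibre (block by block, weights carried along; no choice of pairing made);
  `trace_star_conjR_mul` — the trace pairing `τ(a* b)` of print IS `Ad`-invariant for unitary transporters (cyclicity + `u* = u⁻¹`).
* API: `covDeriv_zero_fun`, `covDerivFwd_zero_fun`, `covDivB_zero`, `covLap_zero`, `qprimeT1_zero`, `QprimeT_zero`, `QT_zero`,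
  `QprimeIter_zero_fun`, `inR138_zero` (0 ∈ R(U₀)), **`isLandau138_zero`** (A = 0 satisfies (1.38), μ = 0), `logCfg_one`,
  **`isLandau138W_one`** (W = 1: the background is in its own Landau gauge, p. 80), `isLandau146_zero_iff` ((1.146) at f = 0 is
  (1.38)), `isLandau146W_zero_iff`; LOCALITY (the hazard №3′ law of the knit: the condition reads A, resp. W, ONLY on the bonds
  with an endpoint in Ω₀ — `covDivB_congr`, **`isLandau138_congr`**, `isLandau146_congr`, `logCfg_congr`, **`isLandau138W_congr`**).

HONEST SCOPE / DECLARED READINGS.  (i) Dirichlet convention: functions on Ω₀ are zero-extended to `ℤᵈ` (`Set.indicator Ω₀`) before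
Δ^η_{U₀} acts and equations are read at the sites of Ω₀ — [4]'s «↾Ω₀» as modelled by `B9Eq322Dirichlet` (the bonds with an
endpoint in Ω₀); A is a bond field read on the bonds with an endpoint in Ω₀ (p. 77 «b ∈ Ω»; `B8Ineq132.BondTouches`).  (ii) The
constraint sets `Λs j` are in level-`j` coordinates and the blocks/transporters are those of (1.29) (`B8Eq119TwistedAxial.Restr129`:
`zdBlocking d L`, `bgT L U₀`), so N(Q′(U₀)) here is the linearisation of exactly the tree's (1.29).  (iii) Nothing is asserted about
existence, uniqueness or size of solutions (Theorems 2/4/8, Proposition 5), about [4]'s inverses or bounds, or about the equality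
of this predicate with the variational/projection forms (see above: a theorem for a family of record with a pairing, modulo b9).
(iv) `L = 0` / `η = 0` give junk stencils (weights `0⁻¹`), as in the sibling carriers; every consumer has `L ≥ 2`, `η > 0`.
Count-neutral; N05 is not discharged by this file; nothing continuum / ℝ⁴ / OS / mass-gap / Clay.  Unit `pub-ymgap-dag-n05-a` (g4),
2026-08-26.  Tree API by name only, nothing restated.
-/

noncomputable section

open Complex (I)

namespace Literature.MathematicalPhysics.QuantumFieldTheory.Balaban1983to89.B8Eq138LandauZd

open MatrixLog B7Prop1Explicit B7Prop2Explicit B7Eq78Linearization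
open B8Ineq132 (covDeriv covDerivFwd BondTouches)
open B8Eq119TwistedAxial (bgT)
open Literature.MathematicalPhysics.QuantumLattice (blockMap)

-- `Site` alone could resolve to the torus sites of `Setup.lean`; re-export the `ℤ^d` sites of `B7Prop1Explicit`.
export B7Prop1Explicit (Site)

variable {d : ℕ}
variable {𝔸 : Type*} [NormedRing 𝔸] [NormedAlgebra ℂ 𝔸] [CompleteSpace 𝔸]

/-! ## §1  The three stencils: `D^{η*}_{U₀}` on bond fields, `Δ^η_{U₀} = D^{η*}D^η`, and the transpose `Q′(U₀)ᵀ` -/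

section Stencils

/-- **`D^{η*}_{U₀}A`**, the covariant divergence of a bond field `A` (`A x μ = A_{⟨x, x+ηe_μ⟩}`): `(D^{η*}_{U₀}A)(x) =
Σ_μ (D^{η*}_{U₀,μ}A_μ)(x)` with (1.1)₂ `(D^{η*}_{U,μ}F)(x) = η⁻¹(R(U(x, x − ηe_μ))F(x − ηe_μ) − F(x))` (`B8Ineq132.covDeriv`) — the
adjoint of `D^η_{U₀} = (D^η_{U₀,μ})_μ` for the counting pairings. [cite: Balaban1985RegularSpaces, (1.1) p.76, (1.38) p.82] -/
def covDivB (η : ℝ) (U₀ : Site d → Fin d → 𝔸ˣ) (A : Site d → Fin d → 𝔸) (x : Site d) : 𝔸 :=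
  ∑ μ : Fin d, covDeriv η U₀ μ (fun z => A z μ) x

/-- **`Δ^η_{U₀} = D^{η*}_{U₀}D^η_{U₀} = Σ_μ D^{η*}_{U₀,μ}D^η_{U₀,μ}`** ([4] (3.23)) on site functions of `ℤᵈ` (no boundary condition;
the Dirichlet reading on Ω₀ is `covLap η U₀ (Set.indicator Ω₀ f)` read on Ω₀). [cite: Balaban1985BackgroundPropagators, (3.23) p.394] -/
def covLap (η : ℝ) (U₀ : Site d → Fin d → 𝔸ˣ) (f : Site d → 𝔸) (x : Site d) : 𝔸 :=
  covDivB η U₀ (fun z μ => covDerivFwd η U₀ μ f z) x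

/-- **One step of the transpose stencil of the linearised averaging**: the step `j ↦ j+1` of `QprimeIter (zdBlocking d L)
(bgT L U₀)` is `(Q′ν)(y) = Σ_{x ∈ B(y)} L⁻ᵈ R(T_j(y, x))ν(x)` ([4] (3.19), `B7Eq78Linearization.Qprime`); its transpose sends a
level-`(j+1)` function `ν` to `x ↦ L⁻ᵈ · R(T_j(y, x))⁻¹ ν(y)` with `y = blockMap L x` the block of `x`
(`QuantumLattice.mem_blockSites_iff`). [cite: Balaban1985BackgroundPropagators, (3.19) p.393; Balaban1985RegularSpaces, (1.29) p.81] -/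
def qprimeT1 (L : ℕ) (U₀ : Site d → Fin d → 𝔸ˣ) (j : ℕ) (ν : Site d → 𝔸) (x : Site d) : 𝔸 :=
  (((L : ℝ) ^ d)⁻¹) • conjR (bgT L U₀ j (blockMap L x) x)⁻¹ (ν (blockMap L x))

/-- **`Q′_j(U₀)ᵀ`**, the transpose stencil of the ITERATED averaging `Q′_j(U₀) = Q′(Ū₀ʲ⁻¹)⋯Q′(U₀)` ([4] (3.19);
`QprimeIter (zdBlocking d L) (bgT L U₀) j`): the one-step transposes composed in reverse order, `(Q′_{j+1})ᵀ = (Q′_j)ᵀ ∘ (step j)ᵀ`.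
[cite: Balaban1985BackgroundPropagators, (3.19) p.393] -/
def QprimeT (L : ℕ) (U₀ : Site d → Fin d → 𝔸ˣ) : ℕ → (Site d → 𝔸) → Site d → 𝔸
  | 0, ν => ν
  | j + 1, ν => QprimeT L U₀ j (qprimeT1 L U₀ j ν)

/-- **`Q′(U₀)ᵀμ` for a multiplier on `𝔅_m = ⋃_{j ≤ m} Λ_j`**: `μ j` is read on `Λ_j` only (zero elsewhere) and the levels are
summed — the transpose of `λ ↦ (Q′_j(U₀)λ↾Λ_j)_{j ≤ m}`; print's positive level weights `a_j(Lʲη)^{d−2}` of (3.24) are absorbed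
into `μ`. [cite: Balaban1985BackgroundPropagators, (3.24) p.394; Balaban1985RegularSpaces, (1.29) p.81] -/
def QT (L m : ℕ) (Λs : ℕ → Set (Site d)) (U₀ : Site d → Fin d → 𝔸ˣ) (μ : ℕ → Site d → 𝔸) (x : Site d) : 𝔸 :=
  ∑ j ∈ Finset.range (m + 1), QprimeT L U₀ j ((Λs j).indicator (μ j)) x

end Stencils

/-! ### §1b  Certificate: `qprimeT1` IS the transpose of the averaging step, for every Ad-invariant pairing

For ANY real-bilinear pairing `B` on the fibre that is invariant under the conjugations `R(u)` (`B(R(u)a, b) = B(a, R(u⁻¹)b)`: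
e.g. `Re tr(a* b)` on matrices for unitary `u`, or the Killing-type forms of a compact Lie algebra), pairing a level-`(j+1)`
function `ν` against the one-step average `Q′λ` over a finite set `S` of blocks equals pairing `qprimeT1 ν` against `λ` over
the sites of those blocks — the adjointness print's `Q′*` denotes, with the block weights carried along. -/

section Transpose

open Literature.MathematicalPhysics.QuantumLattice (blockSites mem_blockSites_iff)

/-- **`qprimeT1` is the transpose of the step `Q′(Ū₀ʲ)` of (3.19)/(1.29)** relative to every `Ad`-invariant real-bilinear pairing
`B` of the fibre: `Σ_{y ∈ S} B(ν(y), (Q′λ)(y)) = Σ_{x ∈ ⋃_{y∈S} B(y)} B((Q′ᵀν)(x), λ(x))`.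
[cite: Balaban1985BackgroundPropagators, (3.19) p.393; Balaban1985RegularSpaces, (1.29) p.81] -/
theorem sum_pairing_Qprime_eq {V : Type*} [AddCommGroup V] [Module ℝ V] (B : 𝔸 →ₗ[ℝ] 𝔸 →ₗ[ℝ] V)
    (hB : ∀ (u : 𝔸ˣ) (a b : 𝔸), B (conjR u a) b = B a (conjR u⁻¹ b)) (L : ℕ) [NeZero L]
    (U₀ : Site d → Fin d → 𝔸ˣ) (j : ℕ) (S : Finset (Site d)) (ν lam : Site d → 𝔸) :
    ∑ y ∈ S, B (ν y) (Qprime ((zdBlocking d L).B j y) ((zdBlocking d L).wt j y) (bgT L U₀ j y) lam) =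
      ∑ x ∈ S.biUnion (blockSites L), B (qprimeT1 L U₀ j ν x) (lam x) := by
  have hdisj : (S : Set (Site d)).PairwiseDisjoint (blockSites L) := by
    intro y _ y' _ hne
    refine Finset.disjoint_left.mpr fun x hx hx' => hne ?_
    rw [mem_blockSites_iff] at hx hx'
    rw [← hx, ← hx']
  rw [Finset.sum_biUnion hdisj]
  refine Finset.sum_congr rfl fun y _ => ?_
  show B (ν y) (∑ x ∈ blockSites L y, ((L : ℝ) ^ d)⁻¹ • conjR (bgT L U₀ j y x) (lam x)) = _
  rw [map_sum]
  refine Finset.sum_congr rfl fun x hx => ?_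
  have hy : blockMap L x = y := (mem_blockSites_iff L y x).mp hx
  rw [map_smul, qprimeT1, hy, map_smul, LinearMap.smul_apply, hB, inv_inv]

omit [CompleteSpace 𝔸] in
/-- **The record's pairing IS `Ad`-invariant**: for any TRACIAL linear functional `τ` (print's `tr` on `𝔤 ⊂ M_N(ℂ)`, p. 393 of [4]:
«⟨λ, λ′⟩ = Σ_{x∈Ω₀} η^d tr λ(x)λ′(x)») and a UNITARY transporter `u`, the sesquilinear pairing `(a, b) ↦ τ(a* b)` satisfies
`τ((R(u)a)* b) = τ(a* (R(u⁻¹)b))` — so its real part is a pairing `B` as in `sum_pairing_Qprime_eq`, and `qprimeT1` is the adjoint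
`Q′*` of print for unitary backgrounds. (Cyclicity of the trace and `u* = u⁻¹`; nothing else.)
[cite: Balaban1985BackgroundPropagators, (3.17) p.393 (the scalar product); Balaban1985RegularSpaces, (1.27) p.80] -/
theorem trace_star_conjR_mul [StarRing 𝔸] (τ : 𝔸 →ₗ[ℂ] ℂ) (hτ : ∀ a b : 𝔸, τ (a * b) = τ (b * a))
    (u : 𝔸ˣ) (hu : (u : 𝔸) ∈ unitary 𝔸) (a b : 𝔸) :
    τ (star (conjR u a) * b) = τ (star a * conjR u⁻¹ b) := by
  have hsu : star (u : 𝔸) = ((u⁻¹ : 𝔸ˣ) : 𝔸) := Units.eq_inv_of_mul_eq_one_left (Unitary.mul_star_self_of_mem hu)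
  have hsui : star ((u⁻¹ : 𝔸ˣ) : 𝔸) = (u : 𝔸) := by rw [← hsu, star_star]
  have h1 : star (conjR u a) * b = (u : 𝔸) * (star a * ((u⁻¹ : 𝔸ˣ) : 𝔸) * b) := by
    simp only [conjR, star_mul, hsu, hsui, mul_assoc]
  have h2 : star a * conjR u⁻¹ b = (star a * ((u⁻¹ : 𝔸ˣ) : 𝔸) * b) * (u : 𝔸) := by
    simp only [conjR, inv_inv, mul_assoc]
  rw [h1, h2, hτ]

end Transpose

/-! ## §2  (1.38) and (1.146) in multiplier form; the configuration reading `A = (iη)⁻¹ log W` -/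

section Landau

/-- **`A = (iη)⁻¹ log W`** bondwise — the Lie-algebra reading of a configuration `W = e^{iηA}` near `1` ((1.36)/(1.69); principal
logarithm `MatrixLog.mlog`, as in `B8Thm4TruncationLocal.base_datum`). [cite: Balaban1985RegularSpaces, (1.36) p.82, (1.69) p.88] -/
def logCfg (η : ℝ) (W : Site d → Fin d → 𝔸ˣ) (x : Site d) (μ : Fin d) : 𝔸 :=
  η⁻¹ • ((I⁻¹ : ℂ) • mlog ((W x μ : 𝔸ˣ) : 𝔸))

/-- **«f is a function from the space R(U₀)»** (p. 101), R(U₀) = Δ^η_{U₀}N(Q′(U₀)) ([4] (3.21)) with `m` averaging levels, constraint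
sets `Λs`, Dirichlet domain Ω₀: `f = Δ^η_{U₀}↾Ω₀ λ` on Ω₀ for some `λ` with `Q′_j(U₀)λ = 0` on `Λ_j`, `j ≤ m`.
[cite: Balaban1985RegularSpaces, (1.146) p.101; Balaban1985BackgroundPropagators, (3.21) p.394] -/
def InR138 (L m : ℕ) (η : ℝ) (Ω₀ : Set (Site d)) (Λs : ℕ → Set (Site d)) (U₀ : Site d → Fin d → 𝔸ˣ)
    (f : Site d → 𝔸) : Prop :=
  ∃ lam : Site d → 𝔸,
    (∀ j, j ≤ m → ∀ y ∈ Λs j, QprimeIter (zdBlocking d L) (bgT L U₀) j (Ω₀.indicator lam) y = 0) ∧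
      ∀ x ∈ Ω₀, f x = covLap η U₀ (Ω₀.indicator lam) x

/-- **(1.38)/(1.42) «R(U₀)D^{η*}_{U₀}A = 0» IN MULTIPLIER FORM** on the `ℤᵈ × 𝔸` carriers: there is a multiplier `μ` on `𝔅_m`
with `Δ^η_{U₀}↾Ω₀(D^{η*}_{U₀}A) = Q′(U₀)ᵀμ` at every site of Ω₀.  Equivalent to print's projection form for the R of [4] (3.25)
built from any (3.25)-inverses (`B8Eq138Multiplier.proj325_apply_eq_zero_iff_exists`; the identification is for the family of
record, modulo [4] Thm 3.11). [cite: Balaban1985RegularSpaces, (1.38) p.82; Balaban1985BackgroundPropagators, (3.25) p.394] -/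
def IsLandau138 (L m : ℕ) (η : ℝ) (Ω₀ : Set (Site d)) (Λs : ℕ → Set (Site d)) (U₀ : Site d → Fin d → 𝔸ˣ)
    (A : Site d → Fin d → 𝔸) : Prop :=
  ∃ μ : ℕ → Site d → 𝔸, ∀ x ∈ Ω₀, covLap η U₀ (Ω₀.indicator (covDivB η U₀ A)) x = QT L m Λs U₀ μ x

/-- **(1.146) «R(U₀)D^{η*}_{U₀}A = f, R(U₀)f = f» IN MULTIPLIER FORM**: `f ∈ R(U₀)` and `Δ^η_{U₀}↾Ω₀(D^{η*}_{U₀}A − f) = Q′(U₀)ᵀμ`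
on Ω₀ for some `μ` (`B8Eq138Multiplier.proj325_apply_eq_iff_exists`). [cite: Balaban1985RegularSpaces, (1.146) p.101] -/
def IsLandau146 (L m : ℕ) (η : ℝ) (Ω₀ : Set (Site d)) (Λs : ℕ → Set (Site d)) (U₀ : Site d → Fin d → 𝔸ˣ)
    (f : Site d → 𝔸) (A : Site d → Fin d → 𝔸) : Prop :=
  InR138 L m η Ω₀ Λs U₀ f ∧
    ∃ μ : ℕ → Site d → 𝔸, ∀ x ∈ Ω₀, covLap η U₀ (Ω₀.indicator (covDivB η U₀ A - f)) x = QT L m Λs U₀ μ x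

/-- **(1.38) for a configuration `W`** (= `U₁ = U′^{u⁻¹} = e^{iηA}` of (1.36)): `IsLandau138` for `A = (iη)⁻¹ log W` — the
instance `Lan m W` of the Theorem-4 knit (`B8Thm4InductionLocal.thm4_exists_all_levels`).
[cite: Balaban1985RegularSpaces, (1.36)–(1.38) p.82] -/
def IsLandau138W (L m : ℕ) (η : ℝ) (Ω₀ : Set (Site d)) (Λs : ℕ → Set (Site d))
    (U₀ W : Site d → Fin d → 𝔸ˣ) : Prop :=
  IsLandau138 L m η Ω₀ Λs U₀ (logCfg η W)

/-- **(1.146) for a configuration `W`** (Theorem 8: `U₁ = U′^{u⁻¹} = e^{iηA}` with source `f`).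
[cite: Balaban1985RegularSpaces, (1.146) p.101] -/
def IsLandau146W (L m : ℕ) (η : ℝ) (Ω₀ : Set (Site d)) (Λs : ℕ → Set (Site d)) (U₀ : Site d → Fin d → 𝔸ˣ)
    (f : Site d → 𝔸) (W : Site d → Fin d → 𝔸ˣ) : Prop :=
  IsLandau146 L m η Ω₀ Λs U₀ f (logCfg η W)

end Landau

/-! ## §3  API: the zero / unit cases (non-vacuity) and locality -/

section API

variable (η : ℝ) (L : ℕ) (U₀ : Site d → Fin d → 𝔸ˣ)

omit [CompleteSpace 𝔸] in
/-- `D^{η*}_{U₀,ν} 0 = 0` (linearity of (1.1)₂). [cite: Balaban1985RegularSpaces, (1.1) p.76] -/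
theorem covDeriv_zero_fun (ν : Fin d) (x : Site d) : covDeriv η U₀ ν (fun _ => (0 : 𝔸)) x = 0 := by
  simp [covDeriv, conjR]

omit [CompleteSpace 𝔸] in
/-- `D^η_{U₀,μ} 0 = 0` (linearity of (1.1)₁). [cite: Balaban1985RegularSpaces, (1.1) p.76] -/
theorem covDerivFwd_zero_fun (μ : Fin d) (x : Site d) : covDerivFwd η U₀ μ (fun _ => (0 : 𝔸)) x = 0 := by
  simp [covDerivFwd, conjR]

omit [CompleteSpace 𝔸] in
/-- `D^{η*}_{U₀} 0 = 0` (linearity of (1.1)₂). [cite: Balaban1985RegularSpaces, (1.1) p.76] -/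
theorem covDivB_zero (x : Site d) : covDivB η U₀ (0 : Site d → Fin d → 𝔸) x = 0 := by
  simp [covDivB, covDeriv, conjR]

omit [CompleteSpace 𝔸] in
/-- `Δ^η_{U₀} 0 = 0` (linearity of (3.23)). [cite: Balaban1985BackgroundPropagators, (3.23) p.394] -/
theorem covLap_zero (x : Site d) : covLap η U₀ (0 : Site d → 𝔸) x = 0 := by
  simp [covLap, covDivB, covDeriv, covDerivFwd, conjR]

/-- one transpose step of `0` is `0` (linearity of (3.19)). [cite: Balaban1985BackgroundPropagators, (3.19) p.393] -/
theorem qprimeT1_zero (j : ℕ) (x : Site d) : qprimeT1 L U₀ j (0 : Site d → 𝔸) x = 0 := by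
  simp [qprimeT1, conjR]

/-- `Q′_j(U₀)ᵀ 0 = 0` (linearity of (3.19)). [cite: Balaban1985BackgroundPropagators, (3.19) p.393] -/
theorem QprimeT_zero : ∀ (j : ℕ) (x : Site d), QprimeT L U₀ j (0 : Site d → 𝔸) x = 0 := by
  intro j
  induction j with
  | zero => intro x; rfl
  | succ j ih =>
    intro x
    have h0 : qprimeT1 L U₀ j (0 : Site d → 𝔸) = 0 := funext (qprimeT1_zero L U₀ j)
    show QprimeT L U₀ j (qprimeT1 L U₀ j 0) x = 0
    rw [h0]
    exact ih x

/-- `Q′(U₀)ᵀ 0 = 0` (the zero multiplier; linearity of (3.19)/(3.24)). [cite: Balaban1985BackgroundPropagators, (3.24) p.394] -/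
theorem QT_zero (m : ℕ) (Λs : ℕ → Set (Site d)) (x : Site d) : QT L m Λs U₀ (fun _ _ => (0 : 𝔸)) x = 0 := by
  unfold QT
  refine Finset.sum_eq_zero fun j _ => ?_
  have h : (Λs j).indicator (fun _ : Site d => (0 : 𝔸)) = 0 := by
    funext y; simp
  rw [h]
  exact QprimeT_zero L U₀ j x

/-- `Q′_j(U₀) 0 = 0` (linearity of the iterated averaging (3.19), `B7Eq78Linearization.QprimeIter_smul` at `c = 0`). [cite: Balaban1985BackgroundPropagators, (3.19) p.393] -/
theorem QprimeIter_zero_fun (j : ℕ) (y : Site d) :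
    QprimeIter (zdBlocking d L) (bgT L U₀) j (fun _ => (0 : 𝔸)) y = 0 := by
  have h := QprimeIter_smul (zdBlocking d L) (bgT L U₀) (0 : ℂ) (fun _ : Site d => (0 : 𝔸)) j
  simp only [zero_smul] at h
  exact congrFun h y

/-- **`0 ∈ R(U₀)`** (λ = 0). [cite: Balaban1985RegularSpaces, (1.146) p.101] -/
theorem inR138_zero (m : ℕ) (Ω₀ : Set (Site d)) (Λs : ℕ → Set (Site d)) : InR138 L m η Ω₀ Λs U₀ (0 : Site d → 𝔸) := by
  refine ⟨fun _ => 0, fun j _ y _ => ?_, fun x _ => ?_⟩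
  · have h : Ω₀.indicator (fun _ : Site d => (0 : 𝔸)) = fun _ => 0 := by funext z; simp
    rw [h]
    exact QprimeIter_zero_fun L U₀ j y
  · have h : Ω₀.indicator (fun _ : Site d => (0 : 𝔸)) = 0 := by funext z; simp
    rw [h, covLap_zero]
    rfl

/-- **NON-VACUITY: `A = 0` satisfies (1.38)** (with the zero multiplier) — relative to any background the trivial perturbation
is in the Landau gauge. [cite: Balaban1985RegularSpaces, (1.38) p.82] -/
theorem isLandau138_zero (m : ℕ) (Ω₀ : Set (Site d)) (Λs : ℕ → Set (Site d)) :
    IsLandau138 L m η Ω₀ Λs U₀ (0 : Site d → Fin d → 𝔸) := by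
  refine ⟨fun _ _ => 0, fun x _ => ?_⟩
  have h : Ω₀.indicator (covDivB η U₀ (0 : Site d → Fin d → 𝔸)) = 0 := by
    funext z
    simp [covDivB_zero]
  rw [h, covLap_zero, QT_zero]

omit [CompleteSpace 𝔸] in
/-- `(iη)⁻¹ log 1 = 0`: the configuration `W = 1` has exponent `A = 0` ((1.36) at `U₁ = 1`). [cite: Balaban1985RegularSpaces, (1.36) p.82] -/
theorem logCfg_one : logCfg η (1 : Site d → Fin d → 𝔸ˣ) = 0 := by
  funext x μ
  simp [logCfg]

/-- **NON-VACUITY: `W = 1` satisfies (1.38)** — p. 80: the background itself (U′ = 1, A′ = 0) is in its own Landau gauge.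
[cite: Balaban1985RegularSpaces, (1.27) p.80] -/
theorem isLandau138W_one (m : ℕ) (Ω₀ : Set (Site d)) (Λs : ℕ → Set (Site d)) :
    IsLandau138W L m η Ω₀ Λs U₀ (1 : Site d → Fin d → 𝔸ˣ) := by
  unfold IsLandau138W
  rw [logCfg_one]
  exact isLandau138_zero η L U₀ m Ω₀ Λs

/-- **(1.146) at `f = 0` is (1.38)**. [cite: Balaban1985RegularSpaces, (1.146) p.101] -/
theorem isLandau146_zero_iff (m : ℕ) (Ω₀ : Set (Site d)) (Λs : ℕ → Set (Site d)) (A : Site d → Fin d → 𝔸) :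
    IsLandau146 L m η Ω₀ Λs U₀ 0 A ↔ IsLandau138 L m η Ω₀ Λs U₀ A := by
  unfold IsLandau146 IsLandau138
  simp only [sub_zero]
  exact ⟨fun h => h.2, fun h => ⟨inR138_zero η L U₀ m Ω₀ Λs, h⟩⟩

/-- (1.146) at `f = 0` is (1.38), configuration form. [cite: Balaban1985RegularSpaces, (1.146) p.101] -/
theorem isLandau146W_zero_iff (m : ℕ) (Ω₀ : Set (Site d)) (Λs : ℕ → Set (Site d)) (W : Site d → Fin d → 𝔸ˣ) :
    IsLandau146W L m η Ω₀ Λs U₀ 0 W ↔ IsLandau138W L m η Ω₀ Λs U₀ W :=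
  isLandau146_zero_iff η L U₀ m Ω₀ Λs _

omit [CompleteSpace 𝔸] in
/-- **Locality of `D^{η*}_{U₀}`**: `(D^{η*}_{U₀}A)(x)` reads `A` only on the `2d` bonds `⟨x − e_μ, x⟩`, `⟨x, x + e_μ⟩`.
[cite: Balaban1985RegularSpaces, (1.1) p.76] -/
theorem covDivB_congr {A A' : Site d → Fin d → 𝔸} {x : Site d}
    (h : ∀ μ : Fin d, A (x - e μ) μ = A' (x - e μ) μ ∧ A x μ = A' x μ) :
    covDivB η U₀ A x = covDivB η U₀ A' x := by
  unfold covDivB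
  refine Finset.sum_congr rfl fun μ _ => ?_
  simp only [covDeriv, (h μ).1, (h μ).2]

/-- **LOCALITY OF (1.38)** (the hazard №3′ law of the knit): the condition reads the bond field `A` ONLY on the bonds with an
endpoint in Ω₀ (p. 77 «b ∈ Ω»): bond fields that agree there satisfy (1.38) together.
[cite: Balaban1985RegularSpaces, (1.38) p.82, p.77 (bond convention)] -/
theorem isLandau138_congr {m : ℕ} {Ω₀ : Set (Site d)} {Λs : ℕ → Set (Site d)} {A A' : Site d → Fin d → 𝔸}
    (h : ∀ (x : Site d) (μ : Fin d), BondTouches Ω₀ x μ → A x μ = A' x μ) :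
    IsLandau138 L m η Ω₀ Λs U₀ A ↔ IsLandau138 L m η Ω₀ Λs U₀ A' := by
  have hind : Ω₀.indicator (covDivB η U₀ A) = Ω₀.indicator (covDivB η U₀ A') := by
    funext x
    by_cases hx : x ∈ Ω₀
    · rw [Set.indicator_of_mem hx, Set.indicator_of_mem hx]
      refine covDivB_congr η U₀ fun μ => ⟨h _ _ (Or.inr ?_), h _ _ (Or.inl hx)⟩
      simpa using hx
    · rw [Set.indicator_of_notMem hx, Set.indicator_of_notMem hx]
  unfold IsLandau138
  rw [hind]

/-- Locality of (1.146) in the bond field. [cite: Balaban1985RegularSpaces, (1.146) p.101] -/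
theorem isLandau146_congr {m : ℕ} {Ω₀ : Set (Site d)} {Λs : ℕ → Set (Site d)} (f : Site d → 𝔸) {A A' : Site d → Fin d → 𝔸}
    (h : ∀ (x : Site d) (μ : Fin d), BondTouches Ω₀ x μ → A x μ = A' x μ) :
    IsLandau146 L m η Ω₀ Λs U₀ f A ↔ IsLandau146 L m η Ω₀ Λs U₀ f A' := by
  have hind : Ω₀.indicator (covDivB η U₀ A - f) = Ω₀.indicator (covDivB η U₀ A' - f) := by
    funext x
    by_cases hx : x ∈ Ω₀
    · rw [Set.indicator_of_mem hx, Set.indicator_of_mem hx, Pi.sub_apply, Pi.sub_apply]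
      congr 1
      refine covDivB_congr η U₀ fun μ => ⟨h _ _ (Or.inr ?_), h _ _ (Or.inl hx)⟩
      simpa using hx
    · rw [Set.indicator_of_notMem hx, Set.indicator_of_notMem hx]
  unfold IsLandau146
  rw [hind]

omit [CompleteSpace 𝔸] in
/-- `(iη)⁻¹ log W` is read bondwise ((1.36): `U₁ = e^{iηA}` bond by bond). [cite: Balaban1985RegularSpaces, (1.36) p.82] -/
theorem logCfg_congr {W W' : Site d → Fin d → 𝔸ˣ} {x : Site d} {μ : Fin d} (h : W x μ = W' x μ) :
    logCfg η W x μ = logCfg η W' x μ := by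
  simp only [logCfg, h]

/-- **LOCALITY OF (1.38) IN THE CONFIGURATION**: configurations that agree on the bonds with an endpoint in Ω₀ satisfy (1.38)
together — so a gauge-fixed `W = U′^{u⁻¹}` is constrained by (1.38) only through its values on Ω₀'s bonds.
[cite: Balaban1985RegularSpaces, (1.38) p.82, p.77 (bond convention)] -/
theorem isLandau138W_congr {m : ℕ} {Ω₀ : Set (Site d)} {Λs : ℕ → Set (Site d)} {W W' : Site d → Fin d → 𝔸ˣ}
    (h : ∀ (x : Site d) (μ : Fin d), BondTouches Ω₀ x μ → W x μ = W' x μ) :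
    IsLandau138W L m η Ω₀ Λs U₀ W ↔ IsLandau138W L m η Ω₀ Λs U₀ W' :=
  isLandau138_congr η L U₀ fun x μ hb => logCfg_congr η (h x μ hb)

/-- Locality of (1.146) in the configuration. [cite: Balaban1985RegularSpaces, (1.146) p.101] -/
theorem isLandau146W_congr {m : ℕ} {Ω₀ : Set (Site d)} {Λs : ℕ → Set (Site d)} (f : Site d → 𝔸)
    {W W' : Site d → Fin d → 𝔸ˣ} (h : ∀ (x : Site d) (μ : Fin d), BondTouches Ω₀ x μ → W x μ = W' x μ) :
    IsLandau146W L m η Ω₀ Λs U₀ f W ↔ IsLandau146W L m η Ω₀ Λs U₀ f W' :=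
  isLandau146_congr η L U₀ f fun x μ hb => logCfg_congr η (h x μ hb)

end API

#print axioms isLandau138_zero
#print axioms isLandau138W_one
#print axioms isLandau138W_congr

end Literature.MathematicalPhysics.QuantumFieldTheory.Balaban1983to89.B8Eq138LandauZd

end
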